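import Summits.ValiantsHypothesis.ValiantsHypothesis.Theorems.KPlusLogSqLawWindowDescartesKernel

/-!
# Window Descartes rule — part 4: the window block and the smoothing identity

Continuation (seat val-sym-lift-p4 (g2), GAP-LIFT §7).  (7c) `sgnChanges_kernel_window_le`: for `p < q ≤ N`, under
dominance of `p` at `a` and of `q` at `b`, the smoothed entries `H p, …, H q` are the two-sided smoothing of the WINDOW
coefficients `c p, …, c q` with the two end coefficients modified WITHOUT change of sign (the tails `s < p`, `s > q` fold into
the ends: `|∑_{s<p} c s b^(s-p)| < |c p|`, `|∑_{s>q} c s a^(s-q)| < |c q|`), hence change sign at most `V(c p, …, c q)` times;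
(7d) `kernel_identity`: the SMOOTHING IDENTITY `(b - a) x f(x) = (b - x)(x - a) P(x) + a f(a) (b - x) + f(b) b⁻¹^N (x - a) x^(N+1)`
with `P = ∑_k H k X^k` (finite form of `f = (1 - x/b)(1 - a/x) h / (1 - a/b)`; two geometric sums).  HONEST FRAMING: elementary
real algebra; no statement of the cell is touched. [folklore]
-/

set_option linter.dupNamespace false
set_option autoImplicit false

namespace Summit.ValiantsHypothesis.ValiantsHypothesis.Theorems.KPlusLogSqLaw.WindowDescartes

open Polynomial

section Kernel

variable {a b : ℝ}

/-- `sign (u + v) = sign u` when `|v| < |u|`. -/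
theorem sign_add_eq_sign_of_abs_lt {u v : ℝ} (h : |v| < |u|) : SignType.sign (u + v) = SignType.sign u := by
  rcases lt_trichotomy u 0 with hu | rfl | hu
  · rw [sign_neg hu, sign_neg]
    have := (abs_lt.mp (lt_of_lt_of_eq h (abs_of_neg hu))).2; linarith
  · simp at h; exact absurd h (not_lt.mpr (abs_nonneg v))
  · rw [sign_pos hu, sign_pos]
    have := (abs_lt.mp (lt_of_lt_of_eq h (abs_of_pos hu))).1; linarith

/-- `b⁻¹ ^ i = b⁻¹ ^ M * b ^ (M - i)` for `i ≤ M`. -/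
theorem inv_pow_eq_inv_pow_mul_pow {b : ℝ} (hb : b ≠ 0) {i M : ℕ} (h : i ≤ M) : b⁻¹ ^ i = b⁻¹ ^ M * b ^ (M - i) := by
  obtain ⟨t, rfl⟩ := Nat.exists_eq_add_of_le h
  rw [Nat.add_sub_cancel_left, mul_comm, Nat.add_comm, pow_mul_inv_pow_add hb t i]

/-- **the window block is a smoothing of the window coefficients with modified ends**: for `p < q ≤ N`, under dominance
of `p` at `a` and of `q` at `b`, the smoothed entries `H (p + i)`, `i ≤ q - p`, change sign at most as often as the
coefficients `c p, …, c q`. -/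
theorem sgnChanges_kernel_window_le (ha : 0 < a) (hab : a < b) (c : ℕ → ℝ) (N p q : ℕ) (hpq : p < q) (hq : q ≤ N)
    (hda : ∑ s ∈ (Finset.range (N + 1)).erase p, |c s| * a ^ s < |c p| * a ^ p)
    (hdb : ∑ s ∈ (Finset.range (N + 1)).erase q, |c s| * b ^ s < |c q| * b ^ q) :
    sgnChanges (slist (fun i => ∑ s ∈ Finset.range (N + 1),
        c s * (if s ≤ p + i then b⁻¹ ^ (p + i - s) else a ^ (s - (p + i)))) (q - p))
      ≤ sgnChanges (slist (fun i => c (p + i)) (q - p)) := by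
  have hb : 0 < b := ha.trans hab
  have hb0 : b ≠ 0 := hb.ne'
  have ha0 : a ≠ 0 := ha.ne'
  obtain ⟨n, rfl⟩ := Nat.exists_eq_add_of_le hpq.le
  have hn : 1 ≤ n := by omega
  simp only [Nat.add_sub_cancel_left]
  -- the modified window coefficients
  set α := ∑ s ∈ Finset.range p, c s * b⁻¹ ^ (p - s) with hα
  set β := ∑ s ∈ Finset.Ico (p + n + 1) (N + 1), c s * a ^ (s - (p + n)) with hβ
  set d : ℕ → ℝ := fun j => c (p + j) + (if j = 0 then α else 0) + (if j = n then β else 0) with hd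
  -- Step A: re-express the window block through `d`
  have stepA : ∀ i, i ≤ n → (∑ s ∈ Finset.range (N + 1), c s * (if s ≤ p + i then b⁻¹ ^ (p + i - s) else a ^ (s - (p + i))))
      = ∑ j ∈ Finset.range (n + 1), d j * (if j ≤ i then b⁻¹ ^ (i - j) else a ^ (j - i)) := by
    intro i hi
    -- right-hand side: middle + α-term + β-term
    have eR : (∑ j ∈ Finset.range (n + 1), d j * (if j ≤ i then b⁻¹ ^ (i - j) else a ^ (j - i)))
        = (∑ j ∈ Finset.range (n + 1), c (p + j) * (if j ≤ i then b⁻¹ ^ (i - j) else a ^ (j - i)))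
          + α * b⁻¹ ^ i + β * a ^ (n - i) := by
      simp only [hd, add_mul, Finset.sum_add_distrib]
      congr 1
      · congr 1
        rw [Finset.sum_eq_single 0 (fun j _ hj => by rw [if_neg hj, zero_mul]) (fun h => absurd (by simp) h)]
        rw [if_pos rfl, if_pos (Nat.zero_le i), Nat.sub_zero]
      · rw [Finset.sum_eq_single n (fun j _ hj => by rw [if_neg hj, zero_mul]) (fun h => absurd (by simp) h)]
        rw [if_pos rfl]
        by_cases hin : n ≤ i
        · rw [if_pos hin, le_antisymm hin hi, Nat.sub_self, pow_zero, pow_zero]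
        · rw [if_neg hin]
    rw [eR]
    -- left-hand side: split `range (N+1)` at `p` and at `p + n + 1`
    rw [Finset.range_eq_Ico, ← Finset.sum_Ico_consecutive _ (Nat.zero_le (p + n + 1)) (by omega : p + n + 1 ≤ N + 1),
      ← Finset.sum_Ico_consecutive _ (Nat.zero_le p) (by omega : p ≤ p + n + 1)]
    have eL : (∑ s ∈ Finset.Ico 0 p, c s * (if s ≤ p + i then b⁻¹ ^ (p + i - s) else a ^ (s - (p + i))))
        = α * b⁻¹ ^ i := by
      rw [hα, Finset.sum_mul, Finset.range_eq_Ico]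
      refine Finset.sum_congr rfl fun s hs => ?_
      rw [Finset.mem_Ico] at hs
      rw [if_pos (by omega), show p + i - s = (p - s) + i by omega, pow_add, mul_assoc]
    have eM : (∑ s ∈ Finset.Ico p (p + n + 1), c s * (if s ≤ p + i then b⁻¹ ^ (p + i - s) else a ^ (s - (p + i))))
        = ∑ j ∈ Finset.range (n + 1), c (p + j) * (if j ≤ i then b⁻¹ ^ (i - j) else a ^ (j - i)) := by
      rw [Finset.sum_Ico_eq_sum_range, show p + n + 1 - p = n + 1 by omega]
      refine Finset.sum_congr rfl fun j _ => ?_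
      by_cases hji : j ≤ i
      · rw [if_pos (by omega), if_pos hji, show p + i - (p + j) = i - j by omega]
      · rw [if_neg (by omega), if_neg hji, show p + j - (p + i) = j - i by omega]
    have eRt : (∑ s ∈ Finset.Ico (p + n + 1) (N + 1), c s * (if s ≤ p + i then b⁻¹ ^ (p + i - s) else a ^ (s - (p + i))))
        = β * a ^ (n - i) := by
      rw [hβ, Finset.sum_mul]
      refine Finset.sum_congr rfl fun s hs => ?_
      rw [Finset.mem_Ico] at hs
      rw [if_neg (by omega), show s - (p + i) = (s - (p + n)) + (n - i) by omega, pow_add, mul_assoc]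
    rw [eL, eM, eRt]
    ring
  -- Step B: the two-sided kernel is variation diminishing
  have stepB := sgnChanges_kernel_le ha hab d n
  -- Step C: `d` has the sign pattern of the window coefficients
  have hαlt : |α| < |c p| := by
    have h1 : a ^ p * |α| ≤ ∑ s ∈ Finset.range p, |c s| * a ^ s := by
      calc a ^ p * |α| ≤ a ^ p * ∑ s ∈ Finset.range p, |c s * b⁻¹ ^ (p - s)| :=
            mul_le_mul_of_nonneg_left (Finset.abs_sum_le_sum_abs _ _) (pow_nonneg ha.le _)
        _ = ∑ s ∈ Finset.range p, |c s| * (a ^ p * b⁻¹ ^ (p - s)) := by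
            rw [Finset.mul_sum]
            refine Finset.sum_congr rfl fun s _ => ?_
            rw [abs_mul, abs_of_nonneg (pow_nonneg (inv_nonneg.mpr hb.le) _)]; ring
        _ ≤ ∑ s ∈ Finset.range p, |c s| * a ^ s := by
            refine Finset.sum_le_sum fun s hs => mul_le_mul_of_nonneg_left ?_ (abs_nonneg _)
            rw [Finset.mem_range] at hs
            obtain ⟨t, rfl⟩ := Nat.exists_eq_add_of_le hs.le
            rw [Nat.add_sub_cancel_left]
            calc a ^ (s + t) * b⁻¹ ^ t ≤ a ^ (s + t) * a⁻¹ ^ t :=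
                  mul_le_mul_of_nonneg_left (pow_le_pow_left₀ (inv_nonneg.mpr hb.le) (inv_anti₀ ha hab.le) _)
                    (pow_nonneg ha.le _)
              _ = a ^ s := pow_add_mul_inv_pow ha0 s t
    have h2 : ∑ s ∈ Finset.range p, |c s| * a ^ s ≤ ∑ s ∈ (Finset.range (N + 1)).erase p, |c s| * a ^ s := by
      refine Finset.sum_le_sum_of_subset_of_nonneg (fun s hs => ?_) (fun s _ _ => mul_nonneg (abs_nonneg _) (pow_nonneg ha.le _))
      rw [Finset.mem_range] at hs
      rw [Finset.mem_erase, Finset.mem_range]; omega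
    have h3 : a ^ p * |α| < a ^ p * |c p| := by linarith [hda]
    exact lt_of_mul_lt_mul_left h3 (pow_nonneg ha.le _)
  have hβlt : |β| < |c (p + n)| := by
    have h1 : b ^ (p + n) * |β| ≤ ∑ s ∈ Finset.Ico (p + n + 1) (N + 1), |c s| * b ^ s := by
      calc b ^ (p + n) * |β| ≤ b ^ (p + n) * ∑ s ∈ Finset.Ico (p + n + 1) (N + 1), |c s * a ^ (s - (p + n))| :=
            mul_le_mul_of_nonneg_left (Finset.abs_sum_le_sum_abs _ _) (pow_nonneg hb.le _)
        _ = ∑ s ∈ Finset.Ico (p + n + 1) (N + 1), |c s| * (b ^ (p + n) * a ^ (s - (p + n))) := by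
            rw [Finset.mul_sum]
            refine Finset.sum_congr rfl fun s _ => ?_
            rw [abs_mul, abs_of_nonneg (pow_nonneg ha.le _)]; ring
        _ ≤ ∑ s ∈ Finset.Ico (p + n + 1) (N + 1), |c s| * b ^ s := by
            refine Finset.sum_le_sum fun s hs => mul_le_mul_of_nonneg_left ?_ (abs_nonneg _)
            rw [Finset.mem_Ico] at hs
            obtain ⟨t, ht⟩ := Nat.exists_eq_add_of_le (show p + n ≤ s by omega)
            rw [ht, Nat.add_sub_cancel_left, pow_add b (p + n) t]
            exact mul_le_mul_of_nonneg_left (pow_le_pow_left₀ ha.le hab.le t) (pow_nonneg hb.le _)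
    have h2 : ∑ s ∈ Finset.Ico (p + n + 1) (N + 1), |c s| * b ^ s ≤ ∑ s ∈ (Finset.range (N + 1)).erase (p + n), |c s| * b ^ s := by
      refine Finset.sum_le_sum_of_subset_of_nonneg (fun s hs => ?_) (fun s _ _ => mul_nonneg (abs_nonneg _) (pow_nonneg hb.le _))
      rw [Finset.mem_Ico] at hs
      rw [Finset.mem_erase, Finset.mem_range]; omega
    have h3 : b ^ (p + n) * |β| < b ^ (p + n) * |c (p + n)| := by linarith [hdb]
    exact lt_of_mul_lt_mul_left h3 (pow_nonneg hb.le _)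
  have stepC : sgnChanges (slist d n) = sgnChanges (slist (fun i => c (p + i)) n) := by
    refine sgnChanges_slist_congr_sign fun j hj => ?_
    simp only [hd]
    by_cases hj0 : j = 0
    · subst hj0
      rw [if_pos rfl, if_neg (by omega), add_zero]
      exact sign_add_eq_sign_of_abs_lt hαlt
    · rw [if_neg hj0, add_zero]
      by_cases hjn : j = n
      · subst hjn; rw [if_pos rfl]; exact sign_add_eq_sign_of_abs_lt hβlt
      · rw [if_neg hjn, add_zero]
  -- assemble
  rw [slist_congr (fun i hi => stepA i hi), ← stepC]
  exact stepB

/-! ### The smoothing identity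

`(b - a)·x·f(x) = (b - x)(x - a)·P(x) + a f(a)·(b - x) + f(b) b⁻¹^N (x - a) x^(N+1)` where `P(x) = ∑_k H k x^k` is the
polynomial of smoothed coefficients: the finite form of `f = (1 - x/b)(1 - a/x)·h/(1 - a/b)` for the Laurent series
`h = ∑_{k ∈ ℤ} H k x^k` (whose two rays below `0` and above `N` are geometric and sum to the two boundary terms). -/

/-- the identity for one monomial `x^s`, `s ≤ N`. -/
theorem kernel_identity_single (ha : 0 < a) (hab : a < b) {N s : ℕ} (hs : s ≤ N) (x : ℝ) :
    (b - a) * x * x ^ s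
      = (b - x) * (x - a) * (∑ k ∈ Finset.range (N + 1), (if s ≤ k then b⁻¹ ^ (k - s) else a ^ (s - k)) * x ^ k)
        + a * a ^ s * (b - x) + b ^ s * b⁻¹ ^ N * (x - a) * x ^ (N + 1) := by
  have hb : 0 < b := ha.trans hab
  have hb0 : b ≠ 0 := hb.ne'
  obtain ⟨M, rfl⟩ := Nat.exists_eq_add_of_le hs
  -- split the sum at `s`
  rw [Finset.range_eq_Ico, ← Finset.sum_Ico_consecutive _ (Nat.zero_le s) (by omega : s ≤ s + M + 1)]
  set P1 := ∑ k ∈ Finset.Ico 0 s, (if s ≤ k then b⁻¹ ^ (k - s) else a ^ (s - k)) * x ^ k with hP1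
  set P2 := ∑ k ∈ Finset.Ico s (s + M + 1), (if s ≤ k then b⁻¹ ^ (k - s) else a ^ (s - k)) * x ^ k with hP2
  -- lower piece: `(x - a) · P1 = a (x^s - a^s)`
  have h1 : (x - a) * P1 = a * (x ^ s - a ^ s) := by
    have e : P1 = a * ∑ k ∈ Finset.range s, x ^ k * a ^ (s - 1 - k) := by
      rw [hP1, Finset.mul_sum, ← Finset.range_eq_Ico]
      refine Finset.sum_congr rfl fun k hk => ?_
      rw [Finset.mem_range] at hk
      rw [if_neg (by omega), show s - k = (s - 1 - k) + 1 by omega, pow_succ]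
      ring
    rw [e, mul_comm (x - a), mul_assoc, geom_sum₂_mul]
  -- upper piece: `(b - x) · P2 = b x^s - x^(s+M+1) b⁻¹^M`
  have h2 : (b - x) * P2 = b * x ^ s - x ^ (s + M + 1) * b⁻¹ ^ M := by
    have e : P2 = x ^ s * b⁻¹ ^ M * ∑ i ∈ Finset.range (M + 1), x ^ i * b ^ (M + 1 - 1 - i) := by
      rw [hP2, Finset.sum_Ico_eq_sum_range, show s + M + 1 - s = M + 1 by omega, Finset.mul_sum]
      refine Finset.sum_congr rfl fun i hi => ?_
      rw [Finset.mem_range] at hi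
      rw [if_pos (by omega), show s + i - s = i by omega, show M + 1 - 1 - i = M - i by omega,
        inv_pow_eq_inv_pow_mul_pow hb0 (by omega : i ≤ M), pow_add]
      ring
    have e2 : b ^ (1 + M) * b⁻¹ ^ M = b ^ 1 := pow_add_mul_inv_pow hb0 1 M
    rw [e, show (b - x) * (x ^ s * b⁻¹ ^ M * ∑ i ∈ Finset.range (M + 1), x ^ i * b ^ (M + 1 - 1 - i))
        = -(x ^ s * b⁻¹ ^ M) * ((∑ i ∈ Finset.range (M + 1), x ^ i * b ^ (M + 1 - 1 - i)) * (x - b)) by ring,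
      geom_sum₂_mul]
    rw [pow_one] at e2
    linear_combination (x ^ s) * e2
  have h3 : b ^ s * b⁻¹ ^ (s + M) = b⁻¹ ^ M := pow_mul_inv_pow_add hb0 s M
  linear_combination (-(b - x)) * h1 + (-(x - a)) * h2 + (-((x - a) * x ^ (s + M + 1))) * h3

/-- **The smoothing identity** `(b - a) x f(x) = (b - x)(x - a) P(x) + a f(a) (b - x) + f(b) b⁻¹^N (x - a) x^(N+1)`. -/
theorem kernel_identity (ha : 0 < a) (hab : a < b) (c : ℕ → ℝ) (N : ℕ) (x : ℝ) :
    (b - a) * x * (∑ s ∈ Finset.range (N + 1), c s * x ^ s)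
      = (b - x) * (x - a) * (∑ k ∈ Finset.range (N + 1),
          (∑ s ∈ Finset.range (N + 1), c s * (if s ≤ k then b⁻¹ ^ (k - s) else a ^ (s - k))) * x ^ k)
        + a * (∑ s ∈ Finset.range (N + 1), c s * a ^ s) * (b - x)
        + (∑ s ∈ Finset.range (N + 1), c s * b ^ s) * b⁻¹ ^ N * (x - a) * x ^ (N + 1) := by
  -- rewrite every term as a sum over `s` of `c s * (…)`
  have eL : (b - a) * x * (∑ s ∈ Finset.range (N + 1), c s * x ^ s)
      = ∑ s ∈ Finset.range (N + 1), c s * ((b - a) * x * x ^ s) := by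
    rw [Finset.mul_sum]; exact Finset.sum_congr rfl fun s _ => by ring
  have e1 : (b - x) * (x - a) * (∑ k ∈ Finset.range (N + 1),
        (∑ s ∈ Finset.range (N + 1), c s * (if s ≤ k then b⁻¹ ^ (k - s) else a ^ (s - k))) * x ^ k)
      = ∑ s ∈ Finset.range (N + 1), c s * ((b - x) * (x - a) *
          ∑ k ∈ Finset.range (N + 1), (if s ≤ k then b⁻¹ ^ (k - s) else a ^ (s - k)) * x ^ k) := by
    rw [Finset.mul_sum]
    simp_rw [Finset.sum_mul, Finset.mul_sum]
    rw [Finset.sum_comm]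
    exact Finset.sum_congr rfl fun s _ => Finset.sum_congr rfl fun k _ => by ring
  have e2 : a * (∑ s ∈ Finset.range (N + 1), c s * a ^ s) * (b - x)
      = ∑ s ∈ Finset.range (N + 1), c s * (a * a ^ s * (b - x)) := by
    rw [Finset.mul_sum, Finset.sum_mul]; exact Finset.sum_congr rfl fun s _ => by ring
  have e3 : (∑ s ∈ Finset.range (N + 1), c s * b ^ s) * b⁻¹ ^ N * (x - a) * x ^ (N + 1)
      = ∑ s ∈ Finset.range (N + 1), c s * (b ^ s * b⁻¹ ^ N * (x - a) * x ^ (N + 1)) := by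
    rw [Finset.sum_mul, Finset.sum_mul, Finset.sum_mul]; exact Finset.sum_congr rfl fun s _ => by ring
  rw [eL, e1, e2, e3, ← Finset.sum_add_distrib, ← Finset.sum_add_distrib]
  refine Finset.sum_congr rfl fun s hs => ?_
  rw [Finset.mem_range] at hs
  rw [← mul_add, ← mul_add, kernel_identity_single ha hab (by omega : s ≤ N) x]

end Kernel

end Summit.ValiantsHypothesis.ValiantsHypothesis.Theorems.KPlusLogSqLaw.WindowDescartes
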